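import Summits.BirchSwinnertonDyer.Rank1Residual.Additive.TwistPartnerForcedCertificateJoin
import Summits.BirchSwinnertonDyer.Rank1Residual.Additive.PlusSymbolsPIntegralOfIrreducible
import HarnessLib

/-!
# X4♯(G-ord), defect 3, 4, 6: the CLASS form of the per-pair join — on an irreducible row the
# integrality input is a theorem, so the rank-one residue is printed facts + boundedness of the
# forced partner + ONE finite unit sum (cell `b2b-bsdres`, sub-cell additive-p2 = X3♯(G-ord) /
# X4♯(G-ord), gen 24; sequel of `TwistPartnerForcedCertificateJoin.lean`)

HONEST FRAMING (cell `b2b-bsdres`, run/shared/lean/b2b/bsd-rank1-residual/, verbatim in every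
file): the goal of the cell is to DELETE the COMBINATION-SHAPED residual classes of the
Birch–Swinnerton-Dyer formula for ALL analytic-rank `≤ 1` elliptic curves over `ℚ` — "full BSD
formula for every rank `≤ 1` curve in class `C`" assembled STRICTLY from published theorems — so
that the rank-`≤ 1` remainder becomes exactly the CONSTRUCTION-SHAPED classes, which are TYPED
(missing-input `Prop`s), NOT attempted. This is not "finishing BSD". Sub-cell additive-p2: the
classes X3♯(G-ord) / X4♯(G-ord) are CONSTRUCTION-SHAPED and stay so; labels / RESIDUAL-MAP marks
UNCHANGED; nothing is booked. THEOREMS ONLY (no definition, no named fact, no conjecture node);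
the named facts Delbourgo 2002 (A) (A175 `Delbourgo2002.mainTheorem`, its (M) twin
`mainTheorem_potMult`), (C) (A227 `Delbourgo2002.thmC_charIdeal_dvd_tameBranch`) and GZK
(`rank_eq_analyticRank_of_analyticRank_le_one`) are hypotheses (referee-1 rule R1), as are the two
per-pair inputs: boundedness of the forced partner and the finite Riemann-sum equality. An
instrument's Riemann sum (HOME/b2b-bsdres-additive-p2/gen23/ENGINE-FORCED-PARTNER.md §4, gen24/) is
EVIDENCE for the latter, never a proof of it.

## What

`TwistPartnerForcedCertificateJoin.lean` proved the per-pair join on the X4-3 locus with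
`PlusSymbolsPIntegralAt W p` as a hypothesis. On class X4 (`E[p]` irreducible) that input is a
THEOREM (`plusSymbolsPIntegralAt_of_classX4`, n1011-p09's T-R18b: Drinfeld–Manin), and on X4♯(G-ord)
(`ClassX4Gord = ClassX4 ∧ TypeGOrd`) the census cell (G-ord) (`SubGord`) is automatic at an additive
`p ≥ 5` (`subGord_iff_typeG_of_addv`). Hence, for `E = W` non-CM on X4♯(G-ord) at `p ≥ 5` with
defect `e ∈ {3,4,6}`, `f` a newform of `E`, `χ = ω^{t(E,p)}`, `ã` a unit:
* `ClassX4Gord.charLamLeAt_of_thmC_of_forcedRiemannSum` — Delbourgo 2002 (A)+(C) + the forced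
  partner `forced χ [·]⁺_f ã` bounded + `‖RS k n‖ = 1` (`k < p`, `n ≥ 1`) ⟹ `CharLamLeAt W p k`;
* `ClassX4Gord.exists_schneider_rankOne_of_thmC_of_forcedRiemannSum` — at `ord_{s=1}L(E,s) = 1`
  with GZK: Schneider `Reg_p(E,Dh) ≠ 0` for EVERY height datum with the (B)-clauses, one exists;
* `ClassX4Gord.padicVal_identity_rankOne_of_thmC_of_forcedRiemannSum` — per cyclotomic datum:
  `λ = 1`, `#Ш[p^∞] < ∞`, `ord Ш[p^∞] + ord Reg_p + ord ∏c + ord ℓ = μ + 1 + 2·ord #tors`.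
So on X4♯(G-ord) ∩ {e ∈ {3,4,6}} ∩ {r_an = 1} the per-pair residue of the tame-branch rank-one
package is EXACTLY: (i) boundedness of ONE explicit function of `E`'s own modular symbols (in print
Manin–Drinfeld for Delbourgo's `f̃`, Atkin–Li 1978 §3 + Delbourgo 1998 §1.5 — the typed input, not a
tree theorem), (ii) ONE finite sum of those symbols being a `p`-adic unit (decidable; EVIDENCE: of the 13
Gord_e346 window rows of gen 23's extension exactly 3 have no rational `p`-isogeny — 2450ba1@7, a unit
row by two engines (gen 24 E-FORCED-4), and 10878bk1@7, 11760bb1@7, not unit rows), and the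
`μ`-invariant left undetermined by the rational (C). The X3♯(G-ord) twin keeps
`PlusSymbolsPIntegralAt` as a hypothesis (it FAILS on `p`-isogeny rows: census 5/142) and is the
statement of `TwistPartnerForcedCertificateJoin.lean` itself. Nothing booked.

References: D. Delbourgo, J. Number Theory 95 (2002) Thm. (A)–(C) p. 40 [Delbourgo2002]; B. Mazur,
J. Tate, J. Teitelbaum, Invent. Math. 84 (1986) §I.10, §I.14 [MazurTateTeitelbaum1986Invent];
W. Stein, C. Wuthrich, Math. Comp. 82 (2013) §3 [SteinWuthrich2013]; Ju. I. Manin, Izv. 36 (1972)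
Cor. 3.6 [Manin1972]; D. Delbourgo, Compositio Math. 113 (1998) §1.5 [Delbourgo1998].
-/

noncomputable section

open scoped Classical MatrixGroups ModularForm NumberField

open CongruenceSubgroup WeierstrassCurve NumberField Literature.NumberTheory.EllipticCurves
  Literature.NumberTheory.EllipticCurves.ModularForms
  Literature.NumberTheory.EllipticCurves.Rank1Residual
  Literature.NumberTheory.EllipticCurves.Rank1Residual.Typed
  Literature.NumberTheory.EllipticCurves.Delbourgo2002
  Summit.BirchSwinnertonDyer.Rank1Residual.X1.MuLambda
  Summit.BirchSwinnertonDyer.Rank1Residual.X11a.LambdaNorm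

namespace Summit.BirchSwinnertonDyer.Rank1Residual.Additive

section ClassX4

variable {W : WeierstrassCurve ℚ} [W.IsElliptic] [W.IsGloballyMinimal] {p : ℕ} [hp : Fact p.Prime]
  {N : ℕ} [NeZero N] {f : CuspForm (Gamma0 N) 2} {χ : MulChar (ZMod p) ℚ_[p]} {ã : ℚ_[p]}
  {RS : ℕ → ℕ → ℚ_[p]}
  (hRS : ∀ k n : ℕ, RS k n =
      ∑ᶠ ξ : rootsOfUnity (Literature.NumberTheory.EllipticCurves.torsionOrder p) ℤ_[p],
        ∑ s : ZMod (p ^ n),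
        twistPartnerMeasure χ
            (TwistPartner.forced χ (fun r ↦ ((ratPlusSymbol f r : ℚ) : ℚ_[p])) ã) ã
            ((ratPlusSymbol f 0 : ℚ) : ℚ_[p]) (n + cyclotomicExponent p)
            (PadicInt.toZModPow (n + cyclotomicExponent p) ((ξ : ℤ_[p]ˣ) : ℤ_[p]) *
              (cyclotomicGenerator p : ZMod (p ^ (n + cyclotomicExponent p))) ^ s.val) *
          ((s.val.choose k : ℕ) : ℚ_[p]))

include hRS

/-- **X4♯(G-ord), defect 3, 4, 6, `p ≥ 5`, non-CM: the λ-certificate from PRINTED facts + the two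
per-pair inputs.** Delbourgo 2002 (A) (`hDel`, `hDelM`) + (C) (`hC`, A227) + boundedness of the forced
partner `forced χ [·]⁺_f ã` (`χ = ω^{t(E,p)}`, `‖ã‖ = 1`) + ONE unit Riemann sum `‖RS k n‖ = 1`
(`k < p`, `n ≥ 1`) ⟹ `CharLamLeAt W p k`. The integrality of the plus symbols is a THEOREM on X4
(`plusSymbolsPIntegralAt_of_classX4`) and `SubGord` is automatic (`subGord_iff_typeG_of_addv`).
[cite: Delbourgo2002, Theorem (A), (C) (p. 40)] [cite: Manin1972, Cor. 3.6] [cite: SteinWuthrich2013, §3] -/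
theorem ClassX4Gord.charLamLeAt_of_thmC_of_forcedRiemannSum
    (hC : Delbourgo2002.thmC_charIdeal_dvd_tameBranch) (hDel : Delbourgo2002.mainTheorem)
    (hDelM : Delbourgo2002.mainTheorem_potMult) (hX : ClassX4Gord W p) (h5 : 5 ≤ p) (hcm : ¬ W.HasCM)
    (he : semistabilityIndex W p ∈ ({3, 4, 6} : Finset ℕ)) (hf : IsNewformOf W f)
    (hχ : CensusX43.IsTeichmullerPow χ (CensusX43.ordinaryTeichmullerExponent W p)) (hã : ‖ã‖ = 1)
    {C₀ : ℝ}
    (hC₀ : ∀ s, ‖TwistPartner.forced χ (fun r ↦ ((ratPlusSymbol f r : ℚ) : ℚ_[p])) ã s‖ ≤ C₀)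
    {k n : ℕ} (hk : k < p) (hn : 1 ≤ n) (hunit : ‖RS k n‖ = 1) : CharLamLeAt W p k :=
  have hadd : Addv W p := hX.addv.2
  have hG : SubGord W p := (subGord_iff_typeG_of_addv W p (by omega) hadd).mpr hX.typeGOrd.typeG
  Additive.charLamLeAt_of_thmC_of_forcedRiemannSum hRS hC hDel hDelM
    (plusSymbolsPIntegralAt_of_classX4 W p hX.1)
    h5 hcm hadd hG he hf hχ hã hC₀ hk hn hunit

/-- **X4♯(G-ord), defect 3, 4, 6, `ord_{s=1} L(E,s) = 1`, `p ≥ 5`, non-CM: SCHNEIDER for Delbourgo's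
datum from PRINTED facts + boundedness of the forced partner + ONE unit Riemann sum** (`n ≥ 1`,
index `1`): `Reg_p(E,Dh) ≠ 0` for every height datum with the (B)-clauses, and one exists (A175).
Printed: Delbourgo 2002 (A), (B), (C); GZK. Typed per pair: Manin–Drinfeld for `f̃` (the bound `C₀`)
and the finite equality. Nothing booked. [cite: Delbourgo2002, Theorem (A), (B), (C) (p. 40)]
[cite: Manin1972, Cor. 3.6] [cite: SteinWuthrich2013, §3] -/
theorem ClassX4Gord.exists_schneider_rankOne_of_thmC_of_forcedRiemannSum
    (hC : Delbourgo2002.thmC_charIdeal_dvd_tameBranch) (hDel : Delbourgo2002.mainTheorem)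
    (hDelM : Delbourgo2002.mainTheorem_potMult) (hGZK : rank_eq_analyticRank_of_analyticRank_le_one)
    (hX : ClassX4Gord W p) (h5 : 5 ≤ p) (hcm : ¬ W.HasCM)
    (he : semistabilityIndex W p ∈ ({3, 4, 6} : Finset ℕ)) (hr : W.analyticRank = 1)
    (hf : IsNewformOf W f)
    (hχ : CensusX43.IsTeichmullerPow χ (CensusX43.ordinaryTeichmullerExponent W p)) (hã : ‖ã‖ = 1)
    {C₀ : ℝ}
    (hC₀ : ∀ s, ‖TwistPartner.forced χ (fun r ↦ ((ratPlusSymbol f r : ℚ) : ℚ_[p])) ã s‖ ≤ C₀)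
    {n : ℕ} (hn : 1 ≤ n) (hunit : ‖RS 1 n‖ = 1) :
    (∀ Dh : PAdicHeightData W p, LeadingTermClauses W p Dh → SchneiderConjecture Dh) ∧
      ∃ Dh : PAdicHeightData W p, LeadingTermClauses W p Dh ∧ SchneiderConjecture Dh :=
  have hadd : Addv W p := hX.addv.2
  have hG : SubGord W p := (subGord_iff_typeG_of_addv W p (by omega) hadd).mpr hX.typeGOrd.typeG
  Additive.exists_schneider_rankOne_of_thmC_of_forcedRiemannSum hRS hC hDel hDelM hGZK
    (plusSymbolsPIntegralAt_of_classX4 W p hX.1) h5 hcm hadd hG he hr hf hχ hã hC₀ hn hunit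

/-- **X4♯(G-ord), defect 3, 4, 6, rank one: THE VALUATION IDENTITY at a pair certified by one finite
sum** (per cyclotomic datum, `μ` carried): with Delbourgo 2002 (A), (C) (typed Kato half discharged),
GZK and `ord_{s=1}L(E,s) = 1`, A175 (B) for the height datum `Dh`, boundedness of the forced partner
and `‖RS 1 n‖ = 1`: `X(E/ℚ_∞)` is `Λ`-torsion with generator `fE`, `λ(fE) = 1`, Schneider,
`#Ш[p^∞] < ∞`, and `ord_p #Ш(E)[p^∞] + ord_p Reg_p(E,Dh) + ord_p ∏c_ℓ + ord_p ℓ = μ(fE) + 1 +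
2·ord_p #E(ℚ)_tors` (`ℓ ∣ p²`, `= 1` off the anomalous rows). `BSD(E,p)` at such a pair is the
statement "`μ(X(E/ℚ_∞)) = ord_p(ℓ·Reg_p(Dh)·L'(E,1)/(Ω_E·Reg_∞)) − 1`". Nothing booked.
[cite: Delbourgo2002, Theorem (A), (B), (C) (p. 40)] [cite: Washington1997, §7.1] -/
theorem ClassX4Gord.padicVal_identity_rankOne_of_thmC_of_forcedRiemannSum
    (hC : Delbourgo2002.thmC_charIdeal_dvd_tameBranch) (hDel : Delbourgo2002.mainTheorem)
    (hDelM : Delbourgo2002.mainTheorem_potMult) (hGZK : rank_eq_analyticRank_of_analyticRank_le_one)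
    (hX : ClassX4Gord W p) (h5 : 5 ≤ p) (hcm : ¬ W.HasCM)
    (he : semistabilityIndex W p ∈ ({3, 4, 6} : Finset ℕ)) (hr : W.analyticRank = 1)
    (hf : IsNewformOf W f)
    (hχ : CensusX43.IsTeichmullerPow χ (CensusX43.ordinaryTeichmullerExponent W p)) (hã : ‖ã‖ = 1)
    {C₀ : ℝ}
    (hC₀ : ∀ s, ‖TwistPartner.forced χ (fun r ↦ ((ratPlusSymbol f r : ℚ) : ℚ_[p])) ã s‖ ≤ C₀)
    {n : ℕ} (hn : 1 ≤ n) (hunit : ‖RS 1 n‖ = 1)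
    {Dh : PAdicHeightData W p} (hBcl : LeadingTermClauses W p Dh)
    {κ : ZpExtension ℚ p} {γ : Field.absoluteGaloisGroup ℚ}
    (hκ : κ.IsCyclotomic) (hγ : κ.IsTopGenerator γ) (hcv : IsCyclotomicVariable p γ)
    (D : W.SelmerDualData κ γ) [Module.Finite (IwasawaAlgebra p) D.X]
    {fE : IwasawaAlgebra p} (hchar : D.charIdeal = Ideal.span {fE}) :
    SchneiderConjecture Dh ∧ Finite (AddCommGroup.primaryComponent W.sha p) ∧
      lam fE = 1 ∧
      ∃ ℓ : ℕ, ℓ ∣ p ^ 2 ∧ (ReductionNonAnomalous W p → ℓ = 1) ∧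
        (padicValNat p (Nat.card (AddCommGroup.primaryComponent W.sha p)) : ℤ) +
            (padicRegulator Dh).valuation + padicValNat p W.tamagawaProduct + padicValNat p ℓ =
          mu fE + 1 + 2 * padicValNat p W.torsionOrder := by
  have hadd : Addv W p := hX.addv.2
  have hG : SubGord W p := (subGord_iff_typeG_of_addv W p (by omega) hadd).mpr hX.typeGOrd.typeG
  obtain ⟨hmw, -⟩ := hGZK W (by rw [hr])
  have hrk : W.mordellWeilRank = 1 := by rw [hmw, hr]
  exact Additive.padicVal_identity_rankOne_of_tameBranchRatDvdAt_of_forcedRiemannSum hRS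
    (tameBranchRatDvdAt_of_thmC hC hDel hDelM h5 hcm) (plusSymbolsPIntegralAt_of_classX4 W p hX.1) h5
    hadd hG he hrk hf hχ hã hC₀ hn hunit hBcl hκ hγ hcv D hchar

end ClassX4

end Summit.BirchSwinnertonDyer.Rank1Residual.Additive

end
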